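import Mathlib
import HarnessLib
import Literature.Probability.LatticeModels.RandomClusterFKG
import Summits.CriticalPhenomena.Ising3DConformalLimit.Theorems.ArmDressingEvenPatternDecouplingPatternTransferDet

/-!
# Crux `EvenPatternDecoupling` (stmt-CriticalPhenomena-16133), line `registered`: restricted open graphs, support, mesh rescaling

Small proved lemmas of the line skeleton (leads c1/c2), landed for durability: two edge configurations that agree on the
edges with both ends in `O` induce the same `O`-restricted open graph (`fromRel_congr_of_agree`, the mechanism behind the
far-measurability of `Uni`/`Patt`); monotonicity of the restricted open graph in the allowed set (`fromRel_restrict_mono`);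
the finite-graph FK measure is carried by configurations of graph edges (`rcMeasure_real_compl_support`); the mesh image of
a site is `δ •` its unit embedding and the rescaling `dist(δy, z) ≤ t ↔ dist(y, δ⁻¹z) ≤ t/δ` (`mesh_eq_smul_emb`,
`dist_mesh_le_iff`, `dist_emb_le_of_dist_mesh_lt`); a Euclidean lattice ball lies in the box eventually
(`eventually_euclLatticeBall_subset_box`).
-/

namespace Summit.CriticalPhenomena.Ising3DConformalLimit.Theorems.EvenPatternDecoupling

open scoped Topology
open Filter Set Metric
open Literature.Probability.LatticeModels Literature.Probability.Percolation Literature.Barriers.CriticalPhenomena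

/-- Two edge configurations that agree on the edges with both ends in `O` induce the same graph of
`O`-internal open edges. -/
-- the header below is the registered stub signature (whitespace-compressed; binders closed at `Type`)
theorem fromRel_congr_of_agree : ∀ {V : Type} (ω ω' : Set (Sym2 V)) (O : Set V) (hag : ∀ x y : V, x ∈ O→y ∈ O→(s(x, y) ∈ ω ↔ s(x, y) ∈ ω')), (SimpleGraph.fromRel fun a a' : V=>s(a, a') ∈ ω ∧ a ∈ O ∧ a' ∈ O) = SimpleGraph.fromRel fun a a' : V=>s(a, a') ∈ ω' ∧ a ∈ O ∧ a' ∈ O := by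
  intro V ω ω' O hag
  ext a a'
  simp only [SimpleGraph.fromRel_adj]
  constructor
  · rintro ⟨hne, h | h⟩
    · exact ⟨hne, Or.inl ⟨(hag a a' h.2.1 h.2.2).1 h.1, h.2.1, h.2.2⟩⟩
    · exact ⟨hne, Or.inr ⟨(hag a' a h.2.1 h.2.2).1 h.1, h.2.1, h.2.2⟩⟩
  · rintro ⟨hne, h | h⟩
    · exact ⟨hne, Or.inl ⟨(hag a a' h.2.1 h.2.2).2 h.1, h.2.1, h.2.2⟩⟩
    · exact ⟨hne, Or.inr ⟨(hag a' a h.2.1 h.2.2).2 h.1, h.2.1, h.2.2⟩⟩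

/-- Monotonicity of the restricted open graph in the allowed vertex set. -/
theorem fromRel_restrict_mono {V : Type*} (ω : Set (Sym2 V)) {O O' : V → Prop} (h : ∀ a, O a → O' a) :
    (SimpleGraph.fromRel fun a a' : V => s(a, a') ∈ ω ∧ O a ∧ O a') ≤
      SimpleGraph.fromRel fun a a' : V => s(a, a') ∈ ω ∧ O' a ∧ O' a' := by
  intro a b hab
  rw [SimpleGraph.fromRel_adj] at hab ⊢
  refine ⟨hab.1, hab.2.imp ?_ ?_⟩
  · rintro ⟨h1, h2, h3⟩; exact ⟨h1, h _ h2, h _ h3⟩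
  · rintro ⟨h1, h2, h3⟩; exact ⟨h1, h _ h2, h _ h3⟩

/-- The finite-graph FK measure is carried by the configurations made of edges of the graph: the set of
configurations using a non-edge is null (`rcMeasure` is an explicit sum of Dirac masses at `ω ⊆ E(G)`). -/
theorem rcMeasure_real_compl_support {V : Type*} [Fintype V] [DecidableEq V] (G : SimpleGraph V)
    [DecidableRel G.Adj] {p q : ℝ} (hp : p ∈ Set.Icc (0:ℝ) 1) (hq : 0 < q) (B : Set V) :
    (Literature.Probability.LatticeModels.rcMeasure G p q B).real
      {ω : Literature.Probability.Percolation.BondConfig V | ω ⊆ G.edgeSet}ᶜ = 0 := by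
  classical
  rw [Literature.Probability.LatticeModels.rcMeasure_real_apply G hp hq B]
  refine Finset.sum_eq_zero fun ω hω => ?_
  have hsub : (↑ω : Literature.Probability.Percolation.BondConfig V) ⊆ G.edgeSet := by
    intro e he
    exact SimpleGraph.mem_edgeFinset.1 (Finset.mem_powerset.1 hω (Finset.mem_coe.1 he))
  rw [if_neg (by simpa using hsub)]

/-- The mesh-`δ` image of a site is `δ •` its unit embedding. -/
theorem mesh_eq_smul_emb (δ : ℝ) (y : Site 3) :
    (WithLp.toLp 2 fun i : Fin 3 => δ * (y i : ℝ) : EuclideanSpace ℝ (Fin 3)) =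
      δ • (WithLp.toLp 2 fun i : Fin 3 => (y i : ℝ) : EuclideanSpace ℝ (Fin 3)) := by
  rw [← WithLp.toLp_smul]
  rfl

/-- Rescaling: `dist(δ y, z) ≤ t ↔ dist(y, δ⁻¹ z) ≤ t/δ`. -/
theorem dist_mesh_le_iff {δ : ℝ} (hδ : 0 < δ) (y : Site 3) (z : EuclideanSpace ℝ (Fin 3)) (t : ℝ) :
    dist (WithLp.toLp 2 fun i : Fin 3 => δ * (y i : ℝ) : EuclideanSpace ℝ (Fin 3)) z ≤ t ↔
      dist (WithLp.toLp 2 fun i : Fin 3 => (y i : ℝ) : EuclideanSpace ℝ (Fin 3)) (δ⁻¹ • z) ≤ t / δ := by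
  rw [mesh_eq_smul_emb]
  conv_lhs => rw [show z = δ • (δ⁻¹ • z) by rw [smul_inv_smul₀ hδ.ne']]
  rw [dist_smul₀, Real.norm_eq_abs, abs_of_pos hδ, le_div_iff₀ hδ, mul_comm]

/-- Rescaling, strict version: `dist(δ y, z) < t → dist(y, δ⁻¹ z) ≤ t/δ`. -/
theorem dist_emb_le_of_dist_mesh_lt {δ : ℝ} (hδ : 0 < δ) (y : Site 3) (z : EuclideanSpace ℝ (Fin 3)) (t : ℝ)
    (h : dist (WithLp.toLp 2 fun i : Fin 3 => δ * (y i : ℝ) : EuclideanSpace ℝ (Fin 3)) z < t) :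
    dist (WithLp.toLp 2 fun i : Fin 3 => (y i : ℝ) : EuclideanSpace ℝ (Fin 3)) (δ⁻¹ • z) ≤ t / δ :=
  (dist_mesh_le_iff hδ y z t).1 h.le

/-- A Euclidean lattice ball lies in the box `Λ_L` eventually in `L`. -/
theorem eventually_euclLatticeBall_subset_box (p : EuclideanSpace ℝ (Fin 3)) (R : ℝ) :
    ∀ᶠ L : ℕ in atTop, {y : Site 3 | dist (WithLp.toLp 2 fun i : Fin 3 => (y i : ℝ) : EuclideanSpace ℝ (Fin 3)) p ≤ R} ⊆
      (box 3 L : Set (Site 3)) := by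
  refine Filter.eventually_atTop.2 ⟨⌈‖p‖ + R⌉₊, fun L hL y hy => ?_⟩
  rw [Finset.mem_coe, mem_box]
  intro i
  have h1 : dist (WithLp.toLp 2 fun i : Fin 3 => (y i : ℝ) : EuclideanSpace ℝ (Fin 3)) p ≤ R := hy
  have h2 : |((y i : ℤ) : ℝ)| ≤ ‖(WithLp.toLp 2 fun i : Fin 3 => (y i : ℝ) : EuclideanSpace ℝ (Fin 3))‖ := by
    have := PiLp.norm_apply_le (WithLp.toLp 2 fun i : Fin 3 => (y i : ℝ) : EuclideanSpace ℝ (Fin 3)) i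
    simpa using this
  have h3 : ‖(WithLp.toLp 2 fun i : Fin 3 => (y i : ℝ) : EuclideanSpace ℝ (Fin 3))‖ ≤ ‖p‖ + R := by
    have := norm_sub_norm_le (WithLp.toLp 2 fun i : Fin 3 => (y i : ℝ) : EuclideanSpace ℝ (Fin 3)) p
    rw [← dist_eq_norm] at this
    linarith
  have h4 : |((y i : ℤ) : ℝ)| ≤ (L : ℝ) := by
    have := Nat.le_ceil (‖p‖ + R)
    have hL' : ((⌈‖p‖ + R⌉₊ : ℕ) : ℝ) ≤ (L : ℝ) := by exact_mod_cast hL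
    linarith
  have h5 : |y i| ≤ (L : ℤ) := by
    have : ((|y i| : ℤ) : ℝ) ≤ ((L : ℤ) : ℝ) := by push_cast; exact h4
    exact_mod_cast this
  rw [abs_le] at h5
  exact h5

end Summit.CriticalPhenomena.Ising3DConformalLimit.Theorems.EvenPatternDecoupling
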